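import Literature.Computability.AlgebraicComplexity.TableauEvalLabelMajor
import HarnessLib

/-!
# Keyed literal layers for the label-major certificate chunks

Topic `Computability/AlgebraicComplexity`; an EXECUTABLE plumbing file (cell `val-lit`, unit val-lit-t13 g7)
for the kernel certificates of Dörfler–Ikenmeyer–Panova 2020, Prop. 5.1 (`DIP20Prop51Certificates47*.lean`,
engines `TableauEval.evalT` / `evalTS` of `ChowPointLabelMajorCertificates.lean`,
`TableauEvalLabelMajorSymm.lean`). No statement about representations, no named fact.

A certificate too large for one `decide +kernel` chunk is cut at a label boundary and the intermediate
LAYER of the dynamic programme — a list of `(key, unused variables of every column, value)` triples,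
`TableauEval.keyOf` packing the state as the bit `i·V + v` for "variable `v` unused in column `i`" — is
written into the file as a literal (`evalT_eq_layerSum_split`, `layersA_append`). Measured on the check
farm (2026-08-27): such a literal elaborates at ≈ 0.17 s per state because of its nested state lists, which
is what limited cuts to thin layers (a few hundred states). Since the state is a FUNCTION of the key, it
need not be written: `decodeLayer V n` rebuilds the `n` column lists from the key inside the kernel, and a
layer is written as `decodeLayer V n [(key, value), …]` — the same term up to `decide`, ≈ 30× cheaper to
elaborate (367 states: 61 s → 2 s) and ≈ 5× shorter, so that layers of several thousand states can serve
as chunk boundaries. Nothing needs to be proved about `decodeLayer`: a chunk lemma `layersA … = decodeLayer V n L` is checked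
by the kernel like any other literal (kernel sanity, checked on the desk: `decodeState 4 14 k` reproduces the
state of key `k = 4559897911674517` of the landed layer of `DIP20Prop51Certificates47W14.lean`, and
`keyOf 4` of it returns `k`).

## References
* [DorflerIkenmeyerPanova2020] J. Dörfler, C. Ikenmeyer, G. Panova, *On geometric complexity theory:
  multiplicity obstructions are stronger than occurrence obstructions*, SIAM J. Appl. Algebra Geom. 4
  (2020) = arXiv:1901.04576, §5 (the label/column transfer-matrix programme, arXiv p. 13).
-/

namespace Literature.Computability.AlgebraicComplexity

namespace TableauEval

/-- The column lists of a packed state key: column `i < n` gets the ascending list of the variables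
`v < V` whose bit `i·V + v` is set (the inverse of `keyOf V` on states with ascending column lists and
variables `< V`). [cite: DorflerIkenmeyerPanova2020, §5 (the dynamic programme, arXiv p. 13)] -/
def decodeState (V n key : ℕ) : List (List ℕ) :=
  (List.range n).map fun i => (List.range V).filter fun v => Nat.testBit key (i * V + v)

/-- **Keyed literal layer**: `(key, value)` pairs expanded to the `(key, state, value)` triples of the
label-major programme (`layersA` / `layersS`), the state being decoded from the key.
[cite: DorflerIkenmeyerPanova2020, §5 (the dynamic programme, arXiv p. 13)] -/
def decodeLayer {R : Type*} (V n : ℕ) (L : List (ℕ × R)) : List (ℕ × List (List ℕ) × R) :=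
  L.map fun kv => (kv.1, decodeState V n kv.1, kv.2)

end TableauEval

end Literature.Computability.AlgebraicComplexity
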